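import Summits.BirchSwinnertonDyer.BirchSwinnertonDyer.Theorems.KolyvaginDepthDoorKolyvaginDepthSupplyDoorNoTwistOfPrint
import Literature.NumberTheory.EllipticCurves.SelmerTorsionTwistRestriction
import HarnessLib

/-!
# Route `KolyvaginDepthDoor`, crux `KolyvaginDepthSupply` (stmt-BirchSwinnertonDyer-21765) —
# the twist-free door, OTHER EIGENSPACE: Kolyvagin's bound `#Sel(E/K)_p^{-} ≤ p^{ν}` read on the
# twist `E^{(d_K)}` over `ℚ`, still WITHOUT a point on the twist

Helper file (`--supports stmt-BirchSwinnertonDyer-21765 --as helper`); it closes nothing and BSD is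
not proved by it.

`…KolyvaginDepthSupplyDoorNoTwist` read the `+`-eigenspace bound over `ℚ` (`Sel_p(E/ℚ) ↪ Sel_p(E/K)^+`,
Literature `SelmerTorsionRestriction`). Kolyvagin's descent at the minimal depth gives a SIGNED pair
of bounds (`HypothesesDepth.card_sel_le_of_ne_zero`, proved): for some sign `e`,
`#Sel(E/K)_p^{e} ≤ p^{ν+1}` and `#Sel(E/K)_p^{-e} ≤ p^{ν}`. With `ν + 1 ≤ rank E(ℚ)` the `+`-space
contains `Sel_p(E/ℚ)` of order `p^{ν+1} > p^{ν}`, so `e = +1` and the `−`-space has order `≤ p^{ν}`.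
The new Literature file `SelmerTorsionTwistRestriction` (this seat, PROVED, no named fact) supplies
the other half of Gross's decomposition (5.1) at finite level: `Sel_p(E^{(d_K)}/ℚ) ↪ Sel_p(E/K)^-`
(the twist isomorphism `E^{(d_K)} ≅ E` over `K` is anti-equivariant for the complex conjugation,
`conjAct_hPsiKT`). Hence **`#Sel_p(E^{(d_K)}/ℚ) ≤ p^{ν}`** — for the rank-2 rows `#Sel_p(E^{(D)}/ℚ) ≤ p`,
i.e. `dim_{𝔽_p} Sel_p(E^{(D)}/ℚ) ≤ 1`, the hF-free and twist-point-free counterpart of the hF-rows'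
`corank Sel_{p^∞}(E^{(D)}/ℚ) = 1` (Kolyvagin 1991 Thm. 4, second eigenspace).

* `natCard_selmerGroup_twist_le_of_hypothesesDepth` — the abstract statement (any `HypothesesDepth`
  `S` on `H¹(K, E[m])`, `m = p`, `S.Sel = Sel(E/K)`, `S.τ = conjAct W c`, `S.p = p`; `S.c n₁ ≠ 0` at
  depth `ν₁`; `ν₁ + 1 ≤ rank E(ℚ)`): `Sel_p(E^{(d_K)}/ℚ)` is finite of order `≤ p^{ν₁}`, and the descent
  count on the twist reads `p^{rank E^{(d_K)}(ℚ)} · #E^{(d_K)}(ℚ)[p] · #Ш(E^{(d_K)}/ℚ)[p] ≤ p^{ν₁}`.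
* `natCard_selmerGroup_twist_le_of_kolyvaginClass_ne_zero_of_system`, `…_of_print` — the crux's
  currency (system `d`, index `p^1`) and the named-McCallum-facts version, rank-2 slice:
  `#Sel_p(E^{(d_K)}/ℚ) ≤ p`.

Trust base: as `…DoorNoTwistOfPrint` (five S/M leaves, compatible system, bit); NO twist point, NO
Kolyvagin Thm. 4. Per-curve; BSD is not proved by it.

References: [Kolyvagin1991MathAnn] Thm. 2.3; [GrossLMS1991] §5 (5.1), §10; [SilvermanAEC2009] X.4.2,
X.5 Cor. 5.4; [Dokchitser2013ParityNotes] §4.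
-/

set_option linter.dupNamespace false

noncomputable section

open scoped Classical

namespace Summit.BirchSwinnertonDyer.BirchSwinnertonDyer.Theorems.KolyvaginDepthDoor

open Literature.NumberTheory.EllipticCurves Literature.NumberTheory.EllipticCurves.ModularForms
  Literature.NumberTheory.EllipticCurves.KolyvaginDescent
  Literature.NumberTheory.EllipticCurves.McCallum1991 WeierstrassCurve NumberField IsDedekindDomain

/-! ## The abstract statement -/

/-- **Kolyvagin's second eigen-bound read on the twist, without a twist point.** Setting of
`door_of_hypothesesDepth`: `E/ℚ` elliptic, `K` quadratic with non-trivial automorphism `c`, `p` odd,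
`m = p`, `S` descent data on `H¹(K, E[m])` with `S.Sel = Sel(E/K)`, `S.τ = conjAct W c`, `S.p = p`;
`S.c n₁ ≠ 0` at a square-free product `n₁` of `S`-Kolyvagin primes with `ν₁` prime factors;
`ν₁ + 1 ≤ rank E(ℚ)`. Then `Sel_p(E^{(d_K)}/ℚ)` is finite with `#Sel_p(E^{(d_K)}/ℚ) ≤ p^{ν₁}`, and
(descent count on the twist, Silverman X.4.2)
`p^{rank E^{(d_K)}(ℚ)} · #E^{(d_K)}(ℚ)[p] · #Ш(E^{(d_K)}/ℚ)[p] ≤ p^{ν₁}`. Proof: Kolyvagin's signed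
bounds (`card_sel_le_of_ne_zero`); the sign is `+` because `Sel_p(E/ℚ)` (order `p^{ν₁+1}` by
`door_of_hypothesesDepth`) embeds in `Sel(E/K)_p^+`; then `Sel_p(E^{(d_K)}/ℚ) ↪ Sel(E/K)_p^-`
(`natCard_selmerGroup_quadraticTwist_discr_le_of_forall_mem`, file `SelmerTorsionTwistRestriction`).
Conditional only on `S`; per-curve; BSD is not proved by it. [cite: Kolyvagin1991MathAnn, Thm. 2.3]
[cite: GrossLMS1991, §5 (5.1) and §10] [cite: SilvermanAEC2009, Thm X.4.2 and X.5 Cor. 5.4] -/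
theorem natCard_selmerGroup_twist_le_of_hypothesesDepth (W : WeierstrassCurve ℚ) [W.IsElliptic]
    (K : Type) [Field K] [NumberField K] (hK2 : Module.finrank ℚ K = 2) (c : K ≃ₐ[ℚ] K) (hc : c ≠ 1)
    (p : ℕ) [hp : Fact p.Prime] (hp2 : p ≠ 2) {m : ℕ} (hm : m = p) {Pl : Type*}
    (S : HypothesesDepth (galH1Torsion (W.baseChange K) (m : ℤ)) Pl)
    (hSel : S.Sel = selmerGroup (W.baseChange K) (m : ℤ)) (hSp : S.p = p)
    (hSτ : S.τ = conjAct W c (m : ℤ))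
    {n₁ : ℕ} (hn₁ : KolSupp S.Kol n₁) (hne : S.c n₁ ≠ 0)
    (hrank : n₁.primeFactors.card + 1 ≤ W.mordellWeilRank) :
    Finite ↥(selmerGroup (W.quadraticTwist (NumberField.discr K : ℚ)) (m : ℤ)) ∧
      Nat.card ↥(selmerGroup (W.quadraticTwist (NumberField.discr K : ℚ)) (m : ℤ)) ≤
        p ^ n₁.primeFactors.card ∧
      p ^ (W.quadraticTwist (NumberField.discr K : ℚ)).mordellWeilRank *
          Nat.card ↥(AddSubgroup.torsionBy (W.quadraticTwist (NumberField.discr K : ℚ)).toAffine.Point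
            (m : ℤ)) *
          Nat.card ↥((W.quadraticTwist (NumberField.discr K : ℚ)).sha ⊓
            AddSubgroup.torsionBy (W.quadraticTwist (NumberField.discr K : ℚ)).galH1 (m : ℤ)) ≤
        p ^ n₁.primeFactors.card := by
  -- the `+`-side: `#Sel_p(E/ℚ) = p^{ν₁+1}`
  obtain ⟨-, -, -, -, -, hcardQ⟩ := door_of_hypothesesDepth W K hK2 c hc p hp2 hm S hSel hSp hSτ hn₁
    hne hrank
  subst hm
  have hpP : m.Prime := hp.out
  -- Kolyvagin's signed bounds
  obtain ⟨-, -, e, he, hfinE, hcardE, hfinO, hcardO⟩ := S.card_sel_le_of_ne_zero hn₁ hne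
  rw [hSp] at hcardE hcardO
  -- the sign is `+1`: otherwise `Sel_p(E/ℚ)` (order `p^{ν+1}`) would sit in a group of order `≤ p^ν`
  have he1 : e = 1 := by
    rcases he with h | h
    · exact h
    · exfalso
      subst h
      rw [neg_neg] at hfinO hcardO
      haveI := hfinO
      have hT : ∀ s ∈ selmerGroup (W.baseChange K) (m : ℤ), conjAct W c (m : ℤ) s = (1 : ℤ) • s →
          s ∈ S.eigenSel 1 := fun s hs hτ ↦ by
        rw [S.mem_eigenSel, hSel, hSτ]
        exact ⟨hs, hτ⟩
      obtain ⟨-, hle⟩ := natCard_selmerGroup_le_of_forall_mem_of_finrank_eq_two K W c hK2 hc hpP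
        hp2 (S.eigenSel 1) hT
      rw [hcardQ] at hle
      have hlt : m ^ n₁.primeFactors.card < m ^ (n₁.primeFactors.card + 1) :=
        Nat.pow_lt_pow_right hpP.one_lt (by omega)
      omega
  subst he1
  haveI := hfinO
  -- the `−`-side: `Sel_p(E^{(d_K)}/ℚ) ↪ Sel(E/K)_p^-`
  have hT : ∀ s ∈ selmerGroup (W.baseChange K) (m : ℤ), conjAct W c (m : ℤ) s = (-1 : ℤ) • s →
      s ∈ S.eigenSel (-1) := fun s hs hτ ↦ by
    rw [S.mem_eigenSel, hSel, hSτ]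
    exact ⟨hs, hτ⟩
  obtain ⟨hfinT, hleT⟩ := natCard_selmerGroup_quadraticTwist_discr_le_of_forall_mem W K hK2 c hc hpP
    hp2 (S.eigenSel (-1)) hT
  have hle : Nat.card ↥(selmerGroup (W.quadraticTwist (NumberField.discr K : ℚ)) (m : ℤ)) ≤
      m ^ n₁.primeFactors.card :=
    hleT.trans hcardO
  -- the descent count on the twist
  have hdK : (NumberField.discr K : ℚ) ≠ 0 := by exact_mod_cast NumberField.discr_ne_zero K
  haveI := W.isElliptic_quadraticTwist hdK
  have hcount := (W.quadraticTwist (NumberField.discr K : ℚ)).natCard_selmerGroup_eq hpP.ne_zero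
  refine ⟨hfinT, hle, ?_⟩
  calc _ = Nat.card ↥(selmerGroup (W.quadraticTwist (NumberField.discr K : ℚ)) (m : ℤ)) := by
          convert hcount.symm
    _ ≤ m ^ n₁.primeFactors.card := hle

/-! ## The crux's currency (system of Kolyvagin–Heegner data, index `p^1`) -/

section System

variable {W : WeierstrassCurve ℚ} [W.IsElliptic] [W.IsGloballyMinimal] [NeZero (W.conductorNorm ℤ)]
  {K : Type} [Field K] [NumberField K]
  {Dt : ModularParametrizationData W (W.conductorNorm ℤ)} {β : ℤ} {ι : K →+* ℂ}

/-- **`#Sel_p(E^{(d_K)}/ℚ) ≤ p` on the crux's objects, rank-2 slice, no twist point.** In the setting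
of `exists_hypothesesDepth_of_system` (file `…DoorOfSystem`: `E/ℚ` globally minimal without CM, `K`
imaginary quadratic with complex conjugation `c`, `p` odd with `ρ̄_{E,p^n}` onto for all `n`, a system
`d` of Kolyvagin–Heegner data, the displayed Euler-system / duality hypotheses `hτc`, `hfin`, `hinf`,
`h44`, `hcyc`, `hdual`): the bit `(d ℓ).kolyvaginClass hp 1 ≠ 0` at ONE Kolyvagin prime `ℓ` and two
independent points on `E(ℚ)` give `#Sel^(p)(E^{(d_K)}/ℚ) ≤ p` (index `p^1`), and the descent count on
the twist `p^{rank E^{(d_K)}} · #E^{(d_K)}(ℚ)[p] · #Ш(E^{(d_K)}/ℚ)[p] ≤ p`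
(`natCard_selmerGroup_twist_le_of_hypothesesDepth` at `m = p^1`). CONDITIONAL on the displayed
hypotheses; per-curve; BSD is not proved by it. [cite: Kolyvagin1991MathAnn, Thm. 2.3]
[cite: GrossLMS1991, §5 (5.1) and §10] -/
theorem natCard_selmerGroup_twist_le_of_kolyvaginClass_prime_ne_zero_of_system (hcm : ¬ W.HasCM)
    (hK : IsImaginaryQuadratic K) (p : ℕ) [hp : Fact p.Prime] (hp2 : p ≠ 2)
    (htower : ∀ n : ℕ, W.HasSurjectiveModNGaloisRep (p ^ n : ℕ))
    (c : K ≃ₐ[ℚ] K) (hc : c ≠ 1) (hcc : c * c = 1)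
    (d : ∀ n : ℕ, KolyvaginHeegnerData Dt β ι n) (ε : ℤ) (hε : ε = 1 ∨ ε = -1)
    (hτc : ∀ n : ℕ, Squarefree n →
      (∀ q ∈ n.primeFactors, Zhang2014.IsKolyvaginPrime (W.conductorNorm ℤ) W K p q) →
      conjAct W c ((p ^ 1 : ℕ) : ℤ) ((d n).kolyvaginClass hp.out 1) =
        (ε * (-1) ^ n.primeFactors.card) • (d n).kolyvaginClass hp.out 1)
    (hfin : ∀ n : ℕ, Squarefree n →
      (∀ q ∈ n.primeFactors, Zhang2014.IsKolyvaginPrime (W.conductorNorm ℤ) W K p q) →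
      ∀ v : HeightOneSpectrum (𝓞 K), (n : 𝓞 K) ∉ v.asIdeal →
        (d n).kolyvaginClass hp.out 1 ∈
          selmerLocalKer (W.baseChange K) (v.adicCompletion K) ((p ^ 1 : ℕ) : ℤ))
    (hinf : ∀ n : ℕ, Squarefree n →
      (∀ q ∈ n.primeFactors, Zhang2014.IsKolyvaginPrime (W.conductorNorm ℤ) W K p q) →
      ∀ w : InfinitePlace K,
        (d n).kolyvaginClass hp.out 1 ∈ selmerLocalKer (W.baseChange K) w.Completion ((p ^ 1 : ℕ) : ℤ))
    (h44 : ∀ (ℓ m : ℕ), Squarefree (ℓ * m) →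
      (∀ q ∈ (ℓ * m).primeFactors, Zhang2014.IsKolyvaginPrime (W.conductorNorm ℤ) W K p q) →
      Zhang2014.IsKolyvaginPrime (W.conductorNorm ℤ) W K p ℓ →
      ∀ v : HeightOneSpectrum (𝓞 K), (ℓ : 𝓞 K) ∈ v.asIdeal →
        ((d (ℓ * m)).kolyvaginClass hp.out 1 ∈
            selmerLocalKer (W.baseChange K) (v.adicCompletion K) ((p ^ 1 : ℕ) : ℤ) ↔
          (d m).kolyvaginClass hp.out 1 ∈
            (W.baseChange K).torsionLocalKer (v.adicCompletion K) ((p ^ 1 : ℕ) : ℤ)))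
    (hcyc : ∀ ℓ : ℕ, Zhang2014.IsKolyvaginPrime (W.conductorNorm ℤ) W K p ℓ →
      ∀ e : ℤ, (e = 1 ∨ e = -1) →
      ∀ s₁ ∈ selmerGroup (W.baseChange K) ((p ^ 1 : ℕ) : ℤ),
        conjAct W c ((p ^ 1 : ℕ) : ℤ) s₁ = e • s₁ →
      ∀ s₂ ∈ selmerGroup (W.baseChange K) ((p ^ 1 : ℕ) : ℤ),
        conjAct W c ((p ^ 1 : ℕ) : ℤ) s₂ = e • s₂ →
      ∃ a b : ℤ, ¬ ((p : ℤ) ∣ a ∧ (p : ℤ) ∣ b) ∧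
        ∀ v : HeightOneSpectrum (𝓞 K), (ℓ : 𝓞 K) ∈ v.asIdeal →
          a • s₁ + b • s₂ ∈ (W.baseChange K).torsionLocalKer (v.adicCompletion K) ((p ^ 1 : ℕ) : ℤ))
    (hdual : ∀ (T : Finset ℕ), (∀ q ∈ T, Zhang2014.IsKolyvaginPrime (W.conductorNorm ℤ) W K p q) →
      ∀ ℓ ∈ T, ∀ e : ℤ, (e = 1 ∨ e = -1) →
      ∀ x : galH1Torsion (W.baseChange K) ((p ^ 1 : ℕ) : ℤ),
        conjAct W c ((p ^ 1 : ℕ) : ℤ) x = e • x →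
        (∀ v : HeightOneSpectrum (𝓞 K), (∀ q ∈ T, (q : 𝓞 K) ∉ v.asIdeal) →
          x ∈ selmerLocalKer (W.baseChange K) (v.adicCompletion K) ((p ^ 1 : ℕ) : ℤ)) →
        (∀ w : InfinitePlace K, x ∈ selmerLocalKer (W.baseChange K) w.Completion ((p ^ 1 : ℕ) : ℤ)) →
      ∀ s ∈ selmerGroup (W.baseChange K) ((p ^ 1 : ℕ) : ℤ),
        conjAct W c ((p ^ 1 : ℕ) : ℤ) s = e • s →
        (∀ q ∈ T, q ≠ ℓ → ∀ v : HeightOneSpectrum (𝓞 K), (q : 𝓞 K) ∈ v.asIdeal →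
          s ∈ (W.baseChange K).torsionLocalKer (v.adicCompletion K) ((p ^ 1 : ℕ) : ℤ)) →
        ∀ v : HeightOneSpectrum (𝓞 K), (ℓ : 𝓞 K) ∈ v.asIdeal →
          s ∉ (W.baseChange K).torsionLocalKer (v.adicCompletion K) ((p ^ 1 : ℕ) : ℤ) →
          x ∈ selmerLocalKer (W.baseChange K) (v.adicCompletion K) ((p ^ 1 : ℕ) : ℤ))
    {ℓ : ℕ} (hℓ : Zhang2014.IsKolyvaginPrime (W.conductorNorm ℤ) W K p ℓ)
    (hne : (d ℓ).kolyvaginClass hp.out 1 ≠ 0) (h2 : 2 ≤ W.mordellWeilRank) :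
    Finite ↥(selmerGroup (W.quadraticTwist (NumberField.discr K : ℚ)) ((p ^ 1 : ℕ) : ℤ)) ∧
      Nat.card ↥(selmerGroup (W.quadraticTwist (NumberField.discr K : ℚ)) ((p ^ 1 : ℕ) : ℤ)) ≤ p ∧
      p ^ (W.quadraticTwist (NumberField.discr K : ℚ)).mordellWeilRank *
          Nat.card ↥(AddSubgroup.torsionBy (W.quadraticTwist (NumberField.discr K : ℚ)).toAffine.Point
            ((p ^ 1 : ℕ) : ℤ)) *
          Nat.card ↥((W.quadraticTwist (NumberField.discr K : ℚ)).sha ⊓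
            AddSubgroup.torsionBy (W.quadraticTwist (NumberField.discr K : ℚ)).galH1
              ((p ^ 1 : ℕ) : ℤ)) ≤ p := by
  obtain ⟨S, hSel, hSp, hSc, hSK, hSτ⟩ := exists_hypothesesDepth_of_system hcm hK p hp2 htower c hc
    hcc d ε hε hτc hfin hinf h44 hcyc hdual
  have hcard : ℓ.primeFactors.card = 1 := by rw [hℓ.1.primeFactors, Finset.card_singleton]
  have hsupp : KolSupp S.Kol ℓ := by
    rw [hSK]
    exact ⟨hℓ.1.squarefree, fun q hq ↦ by
      rw [hℓ.1.primeFactors, Finset.mem_singleton] at hq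
      exact hq ▸ hℓ⟩
  have hne' : S.c ℓ ≠ 0 := by rw [hSc]; exact hne
  have h := natCard_selmerGroup_twist_le_of_hypothesesDepth W K hK.1 c hc p hp2 (pow_one p) S hSel
    hSp hSτ hsupp hne' (by rw [hcard]; exact h2)
  have hp1 : p ^ ℓ.primeFactors.card = p := by rw [hcard, pow_one]
  exact ⟨h.1, h.2.1.trans hp1.le, h.2.2.trans hp1.le⟩

end System

/-! ## Every Euler-system input by name (McCallum 1991 facts) -/

section Print

variable {W : WeierstrassCurve ℚ} [W.IsElliptic] [W.IsGloballyMinimal] [NeZero (W.conductorNorm ℤ)]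
  {K : Type} [Field K] [NumberField K]
  {Dt : ModularParametrizationData W (W.conductorNorm ℤ)} {β : ℤ} {ι : K →+* ℂ}

/-- **`#Sel_p(E^{(d_K)}/ℚ) ≤ p` for the rank-2 row, all Euler-system inputs named, no twist point.**
Hypotheses VERBATIM those of `shaCorank_eq_zero_of_two_le_rank_of_kolyvaginClass_prime_ne_zero_of_print`
(five named McCallum facts, `E/ℚ` globally minimal without CM, `K` imaginary quadratic Heegner with
`d_K ∉ {−3, −4}`, `p` odd with `ρ̄_{E,p^n}` onto for all `n`, a COMPATIBLE system `d`, ONE Kolyvagin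
prime `ℓ` with the bit, `2 ≤ rank E(ℚ)`); conclusion: `Sel^(p)(E^{(d_K)}/ℚ)` finite of order `≤ p`
(index `p^1`) and `p^{rank E^{(d_K)}} · #E^{(d_K)}(ℚ)[p] · #Ш(E^{(d_K)}/ℚ)[p] ≤ p`. The six hypotheses of
the system version are discharged exactly as in `…DoorOfPrint`. CONDITIONAL on the five named facts;
per-curve; BSD is not proved by it. [cite: Kolyvagin1991MathAnn, Thm. 2.3]
[cite: McCallumLMS1991, §§2–5] [cite: GrossLMS1991, §5 (5.1)] -/
theorem natCard_selmerGroup_twist_le_of_kolyvaginClass_prime_ne_zero_of_print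
    (h54 : sign_conjAct_kolyvaginClass) (h43 : lemma43_kolyvaginClass_mem_selmerLocalKer)
    (h44 : prop44_localOrder_kolyvaginClass_mul_eq) (h53 : lemma53_selmer_eigen_dependent_at)
    (h22 : prop22_reciprocity_eigen_finset)
    (hcm : ¬ W.HasCM) (hK : IsImaginaryQuadratic K) (hD3 : NumberField.discr K ≠ -3)
    (hD4 : NumberField.discr K ≠ -4) (hH : SatisfiesHeegnerHypothesis (W.conductorNorm ℤ) K)
    (p : ℕ) [hp : Fact p.Prime] (hp2 : p ≠ 2)
    (htower : ∀ n : ℕ, W.HasSurjectiveModNGaloisRep (p ^ n : ℕ))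
    (c : K ≃ₐ[ℚ] K) (hc : c ≠ 1) (hcc : c * c = 1)
    (d : ∀ n : ℕ, KolyvaginHeegnerData Dt β ι n)
    (hσ : ∀ (m l : ℕ), ∀ l' ∈ m.primeFactors, ∀ (x : ringClassField K ι m)
      (x' : ringClassField K ι (m * l)),
      (x : ℂ) = x' → (((d (m * l)).σ l' x' : ringClassField K ι (m * l)) : ℂ) = ((d m).σ l' x : ℂ))
    (hS₁ : ∀ (m l : ℕ), ∀ s ∈ (d m).S, ∃ s' ∈ (d (m * l)).S, ∀ (x : ringClassField K ι m)
      (x' : ringClassField K ι (m * l)),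
      (x : ℂ) = x' → ((s' x' : ringClassField K ι (m * l)) : ℂ) = (s x : ℂ))
    (hS₂ : ∀ (m l : ℕ), ∀ s' ∈ (d (m * l)).S, ∃ s ∈ (d m).S, ∀ (x : ringClassField K ι m)
      (x' : ringClassField K ι (m * l)),
      (x : ℂ) = x' → ((s' x' : ringClassField K ι (m * l)) : ℂ) = (s x : ℂ))
    (hemb : ∀ (m l : ℕ) (x : ringClassField K ι m) (x' : ringClassField K ι (m * l)),
      (x : ℂ) = x' → (d (m * l)).emb x' = (d m).emb x)
    {ℓ : ℕ} (hℓ : Zhang2014.IsKolyvaginPrime (W.conductorNorm ℤ) W K p ℓ)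
    (hne : (d ℓ).kolyvaginClass hp.out 1 ≠ 0) (h2 : 2 ≤ W.mordellWeilRank) :
    Finite ↥(selmerGroup (W.quadraticTwist (NumberField.discr K : ℚ)) ((p ^ 1 : ℕ) : ℤ)) ∧
      Nat.card ↥(selmerGroup (W.quadraticTwist (NumberField.discr K : ℚ)) ((p ^ 1 : ℕ) : ℤ)) ≤ p ∧
      p ^ (W.quadraticTwist (NumberField.discr K : ℚ)).mordellWeilRank *
          Nat.card ↥(AddSubgroup.torsionBy (W.quadraticTwist (NumberField.discr K : ℚ)).toAffine.Point
            ((p ^ 1 : ℕ) : ℤ)) *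
          Nat.card ↥((W.quadraticTwist (NumberField.discr K : ℚ)).sha ⊓
            AddSubgroup.torsionBy (W.quadraticTwist (NumberField.discr K : ℚ)).galH1
              ((p ^ 1 : ℕ) : ℤ)) ≤ p := by
  -- `ℓ' ∈ S₁(1)` for every Kolyvagin prime (Zhang's `0 < M(ℓ')`)
  have hS1 : ∀ {n : ℕ}, (∀ q ∈ n.primeFactors, Zhang2014.IsKolyvaginPrime (W.conductorNorm ℤ) W K p q) →
      ∀ q ∈ n.primeFactors, Zhang2014.IsKolyvaginPrime (W.conductorNorm ℤ) W K p q ∧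
        1 ≤ Zhang2014.kolyvaginIndex W p q :=
    fun h q hq ↦ ⟨h q hq, (h q hq).2.2.2.2.2⟩
  -- the sign law (Gross Prop. 5.4 (2))
  obtain ⟨ε, hε, hsign⟩ := h54 W hcm K hK hD3 hD4 hH p hp2 htower c hc Dt β ι 1 le_rfl
  refine natCard_selmerGroup_twist_le_of_kolyvaginClass_prime_ne_zero_of_system hcm hK p hp2
    htower c hc hcc d ε hε (fun n hn hk ↦ hsign n hn (hS1 hk) (d n))
    (fun n hn hk v hv ↦ (h43 W hcm K hK hD3 hD4 hH p hp2 htower Dt β ι 1 le_rfl n hn (hS1 hk)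
      (d n)).1 v hv)
    (fun n hn hk w ↦ (h43 W hcm K hK hD3 hD4 hH p hp2 htower Dt β ι 1 le_rfl n hn (hS1 hk)
      (d n)).2 w)
    (fun l m hsq hk hl v hv ↦ ?_)
    (fun l hl e he s₁ hs₁ hτ₁ s₂ hs₂ hτ₂ ↦ h53 W hcm K hK p hp2 htower c hc 1 le_rfl l hl
      hl.2.2.2.2.2 e he s₁ hs₁ hτ₁ s₂ hs₂ hτ₂)
    (fun T hT l hlT e he x hx hoff hinf s hs hτs hsT v hv hsv ↦
      mem_selmerLocalKer_of_not_mem_torsionLocalKer_of_prop22 h22 W hcm K hK p hp2 htower c hc T hT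
        hlT e he x hx hoff hinf s hs hτs hsT v hv hsv)
    hℓ hne h2
  -- `h44`: McCallum Prop. 4.4 "in particular" for the compatible pair `(d m, d (m l))`
  have hsq' : Squarefree (m * l) := by rwa [Nat.mul_comm] at hsq
  have hk' : ∀ q ∈ (m * l).primeFactors, Zhang2014.IsKolyvaginPrime (W.conductorNorm ℤ) W K p q ∧
      1 ≤ Zhang2014.kolyvaginIndex W p q := by
    rw [Nat.mul_comm]
    exact hS1 hk
  have hlm : ¬ l ∣ m := by
    intro hdiv
    have hll : l * l ∣ l * m := Nat.mul_dvd_mul_left l hdiv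
    exact hl.1.not_isUnit (hsq l hll)
  have hA := kolyvaginClass_mul_mem_selmerLocalKer_iff_of_prop44 h44 W hcm K hK hD3 hD4 hH p hp2
    htower Dt β ι 1 le_rfl m l hsq' hl.1 hlm hk' (d m) (d (m * l)) (hσ m l) (hS₁ m l) (hS₂ m l)
    (hemb m l) v hv
  have hB := kolyvaginClass_mul_mem_torsionLocalKer_iff_of_prop44 h44 W hcm K hK hD3 hD4 hH p hp2
    htower Dt β ι 1 le_rfl m l hsq' hl.1 hlm hk' (d m) (d (m * l)) (hσ m l) (hS₁ m l) (hS₂ m l)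
    (hemb m l) v hv
  have hAB : (d (m * l)).kolyvaginClass (Fact.out : p.Prime) 1 ∈
        selmerLocalKer (W.baseChange K) (v.adicCompletion K) ((p ^ 1 : ℕ) : ℤ) ↔
      (d m).kolyvaginClass (Fact.out : p.Prime) 1 ∈
        (W.baseChange K).torsionLocalKer (v.adicCompletion K) ((p ^ 1 : ℕ) : ℤ) := hA.trans hB
  rw [Nat.mul_comm m l] at hAB
  exact hAB

end Print

end Summit.BirchSwinnertonDyer.BirchSwinnertonDyer.Theorems.KolyvaginDepthDoor

end
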